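import Summits.ResolutionOfSingularities.ResolutionOfSingularities.Theorems.BandCutThreads
import HarnessLib

/-!
# BandCutThreads2 — decomp-res node «BandCut» (lens-5 g33, critic row 205 BOOKED 0 (law banked by name); optional
landing rider INBOX 2026-08-31T09:55:54Z), tree file 3/3 of the node

Content VERBATIM from the decomp-res lens-5 g33 node «BandCut» (818612f8), landing shape
`HOME/decomp-res-lens-5/g33/landing/BandCutLaw.lean` (6d3d9ad4) / `landing/BandCutThreads.lean` (651016ec) (shas =
NODE/PIN STATUS 09:47:52Z = CRITIC-LEDGER row 205); HOME = run/shared/lean/pub/decomp-res; critic row 205 BOOKED 0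
with the law banked BY NAME; landing = optional rider INBOX 2026-08-31T09:55:54Z — provenance and critic text in
full in the first file of the node, `BandCutLaw`.  `--kind proof --supports stmt-ResolutionOfSingularities-31770`;
no aside change, no item.

## This file

Part 2/2 of landing file 2/2 (`BandCutThreads`, cut at the 400-line cap along the node's own section boundary): §5
GLIDERS (`section Glider`): certified TRANSLATING threads from ROOTS with all binders — `gliderExp` / `gliderF` /
`gliderRoot` / `gliderPoint` / `gliderM` / `gliderR` / `gliderStates` and their simp lemmas, the thread `glider q a
c : Thread q (gliderRoot a)` (chart `u₁`, points `c_t·e₂`, states `u₀^a·u₁^{m_t}`), `IsRoot`, translating iff `c_t ≠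
0` i.o., NEVER isolated (the `u₂`-axis is a top line), in band for `a = q`, `q ≥ 3` and out of band for `a = 2q −
1`; `exists_translating_thread_never_isolated`, **`translating_kinds_inhabited`** (the registered (T-tr) half
«leaves every top line i.o. ⇒ isolated i.o.» is FALSE for threads; `OutOfBandIO ∩ Translating` is inhabited).

[WRITER NOTE (decomp-res writer g13): `BandCutLaw` = landing file 1/2 verbatim (one tree file; its 48-line landing
header is reproduced verbatim in `BandCutThreads` — no room for it here next to the provenance under the 400-line
cap); landing file 2/2 is 408 lines, over the tree's 400-line cap, and is cut at the node's own section boundary: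
`BandCutThreads` = §4 (`section Threads`), `BandCutThreads2` = §5 (`section Glider`); the file-level `noncomputable
section` and `open` lines are replayed in each part; sections, section variables (incl. the `variable (K …)` /
`variable {K}` binder switch of §5) and every declaration exactly as in the landing files; `[cite: …]` groups in
docstrings are rendered `(Sources: …)` (tree lint).  No dedup deletions (pre-flight clean).]

(Sources: Hauser2010 §§F–G; HauserPerlega2019PRIMS §3; Giraud1975 §1; BierstoneGrigorievMilmanWlodarczyk2011 Def. 3.1.3.)
-/

noncomputable section

open MvPolynomial
open Literature.AlgebraicGeometry.Resolution
open Literature.AlgebraicGeometry.Resolution.Hauser2010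
open Literature.AlgebraicGeometry.Resolution.PointBlowup
open Summit.ResolutionOfSingularities.ResolutionOfSingularities.Theorems.TightDefectClasses
open Summit.ResolutionOfSingularities.ResolutionOfSingularities.Theorems.ItineraryCutClasses
open Summit.ResolutionOfSingularities.ResolutionOfSingularities.Theorems.LassoCut
open Summit.ResolutionOfSingularities.ResolutionOfSingularities.Theorems.ThreadCut

namespace Summit.ResolutionOfSingularities.ResolutionOfSingularities.Theorems.BandCut

section Glider

variable (K : Type) [Field K] [DecidableEq K]

/-! ## §5 GLIDERS: certified translating threads from roots (all binders), in band and out of band -/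

/-- the exponent `(a, m, 0)`. DEFINITION (support). -/
def gliderExp (a m : ℕ) : Fin 3 →₀ ℕ := Finsupp.single 0 a + Finsupp.single 1 m

/-- the glider polynomial `u₀^a · u₁^m`. DEFINITION (support). -/
def gliderF (a m : ℕ) : MvPolynomial (Fin 3) K := monomial (gliderExp a m) 1

/-- the glider ROOT `⟨u₀^a · u₁, r = 0⟩`. DEFINITION (support). -/
def gliderRoot (a : ℕ) : State (Fin 3) K := ⟨gliderF K a 1, 0⟩

/-- the point `(0, 0, c)` of the exceptional plane of the chart `u₁` (a translation by `c` along `u₂`). DEFINITION (support). -/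
def gliderPoint (c : K) : Fin 3 → K := fun i => if i = 2 then c else 0

/-- the `u₁`-exponents `m_t`: `m₀ = 1`, `m_{t+1} = a + m_t − q`. DEFINITION (support). -/
def gliderM (q a : ℕ) : ℕ → ℕ
  | 0 => 1
  | t + 1 => a + gliderM q a t - q

/-- the boundary `r_t`: `0` at the root, `m_t · e₁` afterwards. DEFINITION (support). -/
def gliderR (q a : ℕ) : ℕ → (Fin 3 →₀ ℕ)
  | 0 => 0
  | t + 1 => Finsupp.single 1 (gliderM q a (t + 1))

/-- the glider states: iterate the tree's `step` in the chart `u₁` at the points `(0,0,c_t)`. DEFINITION (support). -/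
noncomputable def gliderStates (q a : ℕ) (c : ℕ → K) : ℕ → State (Fin 3) K
  | 0 => gliderRoot K a
  | t + 1 => step q 1 (gliderPoint K (c t)) (gliderStates q a c t)

variable {K}

omit [DecidableEq K] in
/-- `gliderExp_zero`: Auxiliary step of this node's calculus, VERBATIM from the lens file (see the module
docstring); the statement is its type. [folklore] -/
@[simp] theorem gliderExp_zero (a m : ℕ) : gliderExp a m 0 = a := by simp [gliderExp]

omit [DecidableEq K] in
/-- `gliderExp_one`: Auxiliary step of this node's calculus, VERBATIM from the lens file (see the module docstring);
the statement is its type. [folklore] -/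
@[simp] theorem gliderExp_one (a m : ℕ) : gliderExp a m 1 = m := by simp [gliderExp]

omit [DecidableEq K] in
/-- `gliderExp_two`: Auxiliary step of this node's calculus, VERBATIM from the lens file (see the module docstring);
the statement is its type. [folklore] -/
@[simp] theorem gliderExp_two (a m : ℕ) : gliderExp a m 2 = 0 := by simp [gliderExp]

omit [DecidableEq K] in
/-- `|(a, m, 0)| = a + m`. [folklore] -/
theorem degree_gliderExp (a m : ℕ) : (gliderExp a m).degree = a + m := by
  unfold gliderExp
  rw [map_add, Finsupp.degree_single, Finsupp.degree_single]

omit [DecidableEq K] in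
/-- support. [folklore] -/
theorem support_gliderF (a m : ℕ) : (gliderF K a m).support = {gliderExp a m} := by
  classical
  unfold gliderF
  rw [support_monomial, if_neg one_ne_zero]

omit [DecidableEq K] in
/-- `u₀^a · u₁^m` as a product of powers. [folklore] -/
theorem gliderF_eq (a m : ℕ) : gliderF K a m = X 0 ^ a * X 1 ^ m := by
  unfold gliderF gliderExp
  rw [X_pow_eq_monomial, X_pow_eq_monomial, monomial_mul, mul_one]

omit [DecidableEq K] in
/-- `ord₀ (u₀^a u₁^m) = a + m`. [folklore] -/
theorem ordZero_gliderF (a m : ℕ) : ordZero (gliderF K a m) = ((a + m : ℕ) : ℕ∞) := by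
  unfold gliderF
  rw [ordZero_monomial _ (one_ne_zero' K), degree_gliderExp]

omit [DecidableEq K] in
/-- THE CHART LAW on the glider exponent: `λ₁(a, m, 0) = (a, a + m − q, 0)`. [folklore] -/
theorem chartExponent_gliderExp (q a m : ℕ) : chartExponent q 1 (gliderExp a m) = gliderExp a (a + m - q) := by
  ext i
  rw [chartExponent_apply, degree_gliderExp]
  fin_cases i <;> simp

omit [DecidableEq K] in
/-- the chart transform of the glider polynomial. [folklore] -/
theorem chartTransform_gliderF (q a m : ℕ) : chartTransform q 1 (gliderF K a m) = gliderF K a (a + m - q) := by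
  classical
  unfold chartTransform
  rw [support_gliderF, Finset.sum_singleton, chartExponent_gliderExp]
  unfold gliderF
  rw [coeff_monomial, if_pos rfl]

omit [DecidableEq K] in
/-- translating along `u₂` does not touch `u₀^a u₁^m`. [folklore] -/
theorem translate_gliderF (c : K) (a m : ℕ) : translate (gliderPoint K c) (gliderF K a m) = gliderF K a m := by
  unfold gliderF
  rw [WeightedBlowup.translate_monomial, Fin.prod_univ_three]
  simp [gliderPoint, gliderExp, X_pow_eq_monomial, monomial_mul]

omit [DecidableEq K] in
/-- cleaning keeps a non-`q`-th-power monomial. [folklore] -/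
theorem deletePthPowers_gliderF {q a m : ℕ} (h : ¬ IsPthPowerExponent q (gliderExp a m)) :
    deletePthPowers q (gliderF K a m) = gliderF K a m := by
  unfold gliderF
  rw [deletePthPowers_monomial, if_neg h]

omit [Field K] [DecidableEq K] in
/-- `a = q`: the exponent `m_t` is constantly `1`. [folklore] -/
theorem gliderM_eq_one {q a : ℕ} (h : a = q) : ∀ t, gliderM q a t = 1
  | 0 => rfl
  | t + 1 => by rw [gliderM, gliderM_eq_one h t]; omega

omit [Field K] [DecidableEq K] in
/-- `(a, m_t, 0)` is never a `q`-th power exponent (`q ≥ 2`; `a = q` has `m_t = 1`, else `q ∤ a`). [folklore] -/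
theorem not_isPthPowerExponent_gliderExp {q a : ℕ} (hq : 2 ≤ q) (ha : a = q ∨ ¬ q ∣ a) (t : ℕ) :
    ¬ IsPthPowerExponent q (gliderExp a (gliderM q a t)) := by
  rw [isPthPowerExponent_iff]
  intro h
  rcases ha with ha | ha
  · have h1 := h 1
    rw [gliderExp_one, gliderM_eq_one ha t] at h1
    have := Nat.le_of_dvd one_pos h1
    omega
  · exact ha (by simpa using h 0)

omit [Field K] [DecidableEq K] in
/-- `gliderR t` is `0` or `m_t · e₁`. [folklore] -/
theorem gliderR_eq (q a t : ℕ) : gliderR q a t = 0 ∨ gliderR q a t = Finsupp.single 1 (gliderM q a t) := by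
  cases t with
  | zero => exact Or.inl rfl
  | succ t => exact Or.inr rfl

/-- **ONE GLIDER STEP** in the tree's model: chart `u₁`, point `(0,0,c)`:
`⟨u₀^a u₁^m, r⟩ ↦ ⟨u₀^a u₁^{a+m−q}, (a+m−q)·e₁⟩` for `r ∈ {0, m·e₁}`. [new] [folklore] -/
theorem step_glider {q a m : ℕ} (hclean : ¬ IsPthPowerExponent q (gliderExp a (a + m - q))) (c : K)
    {r : Fin 3 →₀ ℕ} (hr : r = 0 ∨ r = Finsupp.single 1 m) :
    step q 1 (gliderPoint K c) ⟨gliderF K a m, r⟩ = ⟨gliderF K a (a + m - q), Finsupp.single 1 (a + m - q)⟩ := by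
  classical
  have hF : deletePthPowers q (pointTransform q 1 (gliderPoint K c) ⟨gliderF K a m, r⟩) = gliderF K a (a + m - q) := by
    unfold pointTransform
    rw [show (State.mk (gliderF K a m) r).F = gliderF K a m from rfl, chartTransform_gliderF, translate_gliderF,
      deletePthPowers_gliderF hclean]
  have hr' : newMult q 1 (gliderPoint K c) ⟨gliderF K a m, r⟩ = Finsupp.single 1 (a + m - q) := by
    unfold newMult
    rw [show (State.mk (gliderF K a m) r).F = gliderF K a m from rfl, show (State.mk (gliderF K a m) r).r = r from rfl,
      ordZero_gliderF, ENat.toNat_coe]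
    ext i
    rw [Finsupp.update_apply]
    split_ifs with hi
    · subst hi; rw [Finsupp.single_eq_same]
    · rw [Finsupp.single_apply, if_neg (show (1 : Fin 3) ≠ i from Ne.symm hi), Finsupp.filter_apply]
      rcases hr with rfl | rfl
      · simp
      · rw [Finsupp.single_apply, if_neg (show (1 : Fin 3) ≠ i from Ne.symm hi)]
        simp
  unfold step
  exact congrArg₂ State.mk hF hr'

/-- **THE GLIDER STATES IN CLOSED FORM**: `F_t = u₀^a · u₁^{m_t}`, `r_t = m_t · e₁` (`t ≥ 1`), `r₀ = 0`. [new] [folklore] -/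
theorem gliderStates_eq {q a : ℕ} (hq : 2 ≤ q) (ha : a = q ∨ ¬ q ∣ a) (c : ℕ → K) :
    ∀ t, gliderStates K q a c t = ⟨gliderF K a (gliderM q a t), gliderR q a t⟩
  | 0 => rfl
  | t + 1 => by
    have hcl : ¬ IsPthPowerExponent q (gliderExp a (a + gliderM q a t - q)) :=
      not_isPthPowerExponent_gliderExp hq ha (t + 1)
    rw [gliderStates, gliderStates_eq hq ha c t, step_glider hcl (c t) (gliderR_eq q a t)]
    rfl

/-- **THE GLIDER THREAD** (every field, every `q ≥ 2`, every `a ≥ q` with `a = q ∨ q ∤ a`, EVERY translation sequence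
`c : ℕ → K`): chart `u₁` at every step, point `(0, 0, c_t)` — a `Thread q (gliderRoot a)` with ALL binders (on `E`,
EQUIMULTIPLE, the tree's `step`). DEFINITION (certified inhabitant). [new] -/
noncomputable def glider {q a : ℕ} (hq : 2 ≤ q) (hqa : q ≤ a) (ha : a = q ∨ ¬ q ∣ a) (c : ℕ → K) :
    Thread q (gliderRoot K a) where
  j := fun _ => 1
  b := fun t => gliderPoint K (c t)
  st := gliderStates K q a c
  st_zero := rfl
  st_succ := fun _ => rfl
  onExc := fun _ => by simp [gliderPoint]
  equimult := fun t => by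
    classical
    intro d hd0 hdq
    rw [gliderStates_eq hq ha c t]
    change coeff d (translate (gliderPoint K (c t)) (chartTransform q 1 (gliderF K a (gliderM q a t)))) = 0
    rw [chartTransform_gliderF, translate_gliderF]
    unfold gliderF
    rw [coeff_monomial, if_neg]
    rintro rfl
    rw [degree_gliderExp] at hdq
    omega

/-- bookkeeping: the states of the glider. [folklore] -/
theorem glider_st {q a : ℕ} (hq : 2 ≤ q) (hqa : q ≤ a) (ha : a = q ∨ ¬ q ∣ a) (c : ℕ → K) (t : ℕ) :
    (glider hq hqa ha c).st t = ⟨gliderF K a (gliderM q a t), gliderR q a t⟩ :=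
  gliderStates_eq hq ha c t

/-- bookkeeping: the points of the glider. [folklore] -/
@[simp] theorem glider_b {q a : ℕ} (hq : 2 ≤ q) (hqa : q ≤ a) (ha : a = q ∨ ¬ q ∣ a) (c : ℕ → K) (t : ℕ) :
    (glider hq hqa ha c).b t = gliderPoint K (c t) := rfl

/-- bookkeeping: the charts of the glider. [folklore] -/
@[simp] theorem glider_j {q a : ℕ} (hq : 2 ≤ q) (hqa : q ≤ a) (ha : a = q ∨ ¬ q ∣ a) (c : ℕ → K) (t : ℕ) :
    (glider hq hqa ha c).j t = 1 := rfl

omit [DecidableEq K] in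
/-- **THE GLIDER ROOT IS A ROOT** of lens-5's model (`r = 0`, clean, `ord₀ = a + 1 ≥ q`). [new] [folklore] -/
theorem gliderRoot_isRoot {q a : ℕ} (hq : 2 ≤ q) (hqa : q ≤ a) : IsRoot q (gliderRoot K a) := by
  classical
  refine ⟨rfl, ?_, ?_⟩
  · change deletePthPowers q (gliderF K a 1) = gliderF K a 1
    refine deletePthPowers_gliderF ?_
    rw [isPthPowerExponent_iff]
    intro h
    have := Nat.le_of_dvd one_pos (by simpa using h 1)
    omega
  · change ((q : ℕ) : ℕ∞) ≤ ordZero (gliderF K a 1)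
    rw [ordZero_gliderF]
    exact_mod_cast (by omega : q ≤ a + 1)

/-- **THE ORDER ALONG A GLIDER**: `ord₀ F_t = a + m_t`. [new] [folklore] -/
theorem glider_ordZero {q a : ℕ} (hq : 2 ≤ q) (hqa : q ≤ a) (ha : a = q ∨ ¬ q ∣ a) (c : ℕ → K) (t : ℕ) :
    ordZero ((glider hq hqa ha c).st t).F = ((a + gliderM q a t : ℕ) : ℕ∞) := by
  rw [glider_st]
  exact ordZero_gliderF a _

/-- **GLIDERS ARE NEVER ISOLATED**: the `u₂`-axis is a top line at every stage (`OffHeavy q 2`). [new] [folklore] -/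
theorem glider_not_isolated {q a : ℕ} (hq : 2 ≤ q) (hqa : q ≤ a) (ha : a = q ∨ ¬ q ∣ a) (c : ℕ → K) (t : ℕ) :
    ¬ IsolatedTop q ((glider hq hqa ha c).st t).F := by
  rw [glider_st]
  refine not_isolatedTop_of_offHeavy (j := 2) fun d hd => ?_
  change d ∈ (gliderF K a (gliderM q a t)).support at hd
  rw [support_gliderF, Finset.mem_singleton] at hd
  subst hd
  rw [degree_gliderExp, gliderExp_two]
  omega

/-- … so a glider root carries NO forced walk (the binder `isolated` fails at stage `0`). [new] [folklore] -/
theorem glider_no_forcedWalk {q a : ℕ} (hq : 2 ≤ q) (hqa : q ≤ a) (ha : a = q ∨ ¬ q ∣ a)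
    (W : ForcedWalk q (gliderRoot K a)) : False := by
  have h := glider_not_isolated (K := K) hq hqa ha (fun _ => 0) 0
  rw [glider_st] at h
  have h0 := W.isolated 0
  rw [W.st_zero] at h0
  exact h h0

/-- **TRANSLATING**: the glider translates exactly when `c_t ≠ 0`; with `c_t ≠ 0` infinitely often it is a TRANSLATING
thread. [new] [folklore] -/
theorem glider_translating {q a : ℕ} (hq : 2 ≤ q) (hqa : q ≤ a) (ha : a = q ∨ ¬ q ∣ a) {c : ℕ → K}
    (hc : ∀ N, ∃ t, N ≤ t ∧ c (t + 1) ≠ 0) : (glider hq hqa ha c).Translating := by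
  intro N
  obtain ⟨t, ht, hct⟩ := hc N
  refine ⟨t, ht, fun h => hct ?_⟩
  have := congrFun h 2
  simpa [gliderPoint] using this

/-- **OUT OF BAND FOR EVER** when `a ≥ 2q − 1` (e.g. the heavy glider `a = 2q − 1`): `ord₀ F_t ≥ 2q − 1` at every stage.
[new] [folklore] -/
theorem glider_outOfBandIO {q a : ℕ} (hq : 2 ≤ q) (hqa : q ≤ a) (ha : a = q ∨ ¬ q ∣ a) (h2 : 2 * q - 1 ≤ a)
    (c : ℕ → K) : (glider hq hqa ha c).OutOfBandIO := fun N =>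
  ⟨N, le_rfl, by rw [glider_ordZero]; exact_mod_cast (by omega : 2 * q - 1 ≤ a + gliderM q a N)⟩

/-- **IN BAND FOR EVER** for the light glider `a = q`, `q ≥ 3`: `ord₀ F_t = q + 1 ≤ 2q − 2` at every stage. [new] [folklore] -/
theorem glider_inBand {q : ℕ} (hq : 3 ≤ q) (c : ℕ → K) (t : ℕ) :
    ordZero ((glider (K := K) (a := q) (by omega) le_rfl (Or.inl rfl) c).st t).F ≤ ((2 * q - 2 : ℕ) : ℕ∞) := by
  rw [glider_ordZero, gliderM_eq_one rfl t]
  exact_mod_cast (by omega : q + 1 ≤ 2 * q - 2)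

omit [Field K] [DecidableEq K] in
/-- `q ∤ 2q − 1` for `q ≥ 2`. [folklore] -/
theorem not_dvd_two_mul_sub_one {q : ℕ} (hq : 2 ≤ q) : ¬ q ∣ 2 * q - 1 := by
  intro h
  rw [show 2 * q - 1 = q + (q - 1) by omega, Nat.dvd_add_right (dvd_refl q)] at h
  have := Nat.le_of_dvd (by omega) h
  omega

/-- **THE REGISTERED (T-tr) HALF «leaves every top line i.o. ⇒ isolated i.o.» IS FALSE FOR THREADS, and the half
«eventually on ONE top line» misses every translating thread**: over EVERY field and for EVERY `q ≥ 2` there is a ROOT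
carrying a TRANSLATING thread (a translation at EVERY step) that is NEVER isolated. [new] [folklore] -/
theorem exists_translating_thread_never_isolated {q : ℕ} (hq : 2 ≤ q) :
    ∃ (s₀ : State (Fin 3) K) (T : Thread q s₀), IsRoot q s₀ ∧ T.Translating ∧ (∀ t, T.b t ≠ 0) ∧
      ∀ t, ¬ IsolatedTop q (T.st t).F := by
  refine ⟨gliderRoot K q, glider hq le_rfl (Or.inl rfl) (fun _ => 1), gliderRoot_isRoot hq le_rfl,
    glider_translating hq le_rfl (Or.inl rfl) (fun N => ⟨N, le_rfl, one_ne_zero⟩), fun t h => ?_,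
    glider_not_isolated hq le_rfl (Or.inl rfl) _⟩
  have := congrFun h 2
  simp [gliderPoint] at this

/-- **BOTH ORDER-BAND KINDS OF TRANSLATING THREADS ARE INHABITED FROM ROOTS** (every field, every `q ≥ 3`): an in-band
translating thread (`ord₀ ≡ q + 1`, the light glider) and an out-of-band-i.o. translating thread (`ord₀ ≥ 2q`, the heavy
glider `a = 2q − 1`), both never isolated. [new] [folklore] -/
theorem translating_kinds_inhabited {q : ℕ} (hq : 3 ≤ q) :
    (∃ (s₀ : State (Fin 3) K) (T : Thread q s₀), IsRoot q s₀ ∧ T.Translating ∧ T.EventuallyInBand ∧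
        ∀ t, ¬ IsolatedTop q (T.st t).F) ∧
      ∃ (s₀ : State (Fin 3) K) (T : Thread q s₀), IsRoot q s₀ ∧ T.Translating ∧ T.OutOfBandIO ∧
        ∀ t, ¬ IsolatedTop q (T.st t).F := by
  have hq2 : 2 ≤ q := by omega
  refine ⟨⟨gliderRoot K q, glider hq2 le_rfl (Or.inl rfl) (fun _ => 1), gliderRoot_isRoot hq2 le_rfl,
      glider_translating hq2 le_rfl (Or.inl rfl) (fun N => ⟨N, le_rfl, one_ne_zero⟩),
      ⟨0, fun t _ => glider_inBand hq _ t⟩, glider_not_isolated hq2 le_rfl (Or.inl rfl) _⟩,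
    ⟨gliderRoot K (2 * q - 1), glider hq2 (by omega) (Or.inr (not_dvd_two_mul_sub_one hq2)) (fun _ => 1),
      gliderRoot_isRoot hq2 (by omega),
      glider_translating hq2 (by omega) (Or.inr (not_dvd_two_mul_sub_one hq2)) (fun N => ⟨N, le_rfl, one_ne_zero⟩),
      glider_outOfBandIO hq2 (by omega) (Or.inr (not_dvd_two_mul_sub_one hq2)) le_rfl _,
      glider_not_isolated hq2 (by omega) (Or.inr (not_dvd_two_mul_sub_one hq2)) _⟩⟩

end Glider

end Summit.ResolutionOfSingularities.ResolutionOfSingularities.Theorems.BandCut
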